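import Literature.NumberTheory.GaloisRepresentations.SerreOpenImageGroupLemmas
import HarnessLib

/-!
# "σ-type" elements of `GL₂(𝔽_p)` are transvections; proper irreducible subgroups have none

Topic `NumberTheory/GaloisRepresentations`; theorems only (no definitions, no named facts),
Mathlib and the tree only.  Companion of `SerreSubgroupsGL2Fp` (Serre 1972, §2.4, Prop. 15) and
`SerreOpenImageGroupLemmas` (`Serre1972.eq_top_or_borel_of_dvd_card`).

The hypothesis (im) of the Kolyvagin-system and Euler-system literature — Kato, *Astérisque* 295 (2004),
Thm. 13.4 (3) ("there exists an element `σ` of `Gal(ℚ̄/ℚ(ζ_{p^∞}))` such that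
`Coker(1 - σ : T → T)` is a free `O_L`-module of rank `1`"), Mazur–Rubin, Skinner, Pacific J.
Math. 283 (2016) §2.5 (b), Burungale–Castella–Skinner, IMRN 2025, hypothesis (im): "there exists
an element `σ ∈ G_{ℚ(μ_{p^∞})}` such that `T/(σ - 1)T ≃ ℤ_p`" — has a mod-`p` shadow: the
reduction `g = ρ̄(σ) ∈ GL₂(𝔽_p)` has `det g = 1` (Weil pairing: `det ρ̄ = χ̄_p`, trivial on
`G_{ℚ(μ_p)}`) and `g - 1` of rank exactly one (right exactness of `⊗ 𝔽_p`).  Call such a `g`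
*σ-type*: `det g = 1`, `g ≠ 1`, `det (g - 1) = 0`.  This file proves the finite group theory
deciding where such elements can live:

* `Serre1972.det_sub_one_fin_two` — `det (M - 1) = det M - tr M + 1` for `2 × 2` matrices.
* `Serre1972.orderOf_eq_of_det_eq_one_of_det_sub_one_eq_zero` — **a σ-type element is a
  transvection of order `p`**: `det g = 1` and `det (g - 1) = 0` force `tr g = 2`, so by
  Cayley–Hamilton `(g - 1)² = 0`, and `g^p = 1 + p (g - 1) = 1`.
* `Serre1972.dvd_natCard_of_mem_of_orderOf_eq` — an element of order `p` in `G ≤ GL₂(𝔽_p)` gives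
  `p ∣ #G` (Lagrange).
* `Serre1972.not_dvd_natCard_of_forall_not_le_eigenvectorStabilizer` — **Prop. 15 read
  backwards**: a PROPER subgroup `G < GL₂(𝔽_p)` with `det G = 𝔽_pˣ` that lies in no Borel
  subgroup (no common eigenvector: the irreducible case) has order prime to `p`
  (`eq_top_or_borel_of_dvd_card`).  These are exactly the "exceptional" images of Serre's list —
  `G` contained in the normaliser of a split or non-split Cartan subgroup but in no Borel, or of
  projective image `𝔄₄`, `𝔖₄`, `𝔄₅` — in the only form the argument needs (no case list).
* `Serre1972.eq_one_of_det_eq_one_of_det_sub_one_eq_zero` — hence **such a `G` contains no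
  σ-type element**: an element `g ∈ G` with `det g = 1` and `det (g - 1) = 0` is `g = 1`.
* `Serre1972.ne_zero_and_det_eq_zero_of_natCard_range_mulVecLin` — the linear-algebra bridge used
  by the elliptic-curve companion (`ModPImageTransvectionCriterionProofs`): if the image
  `A · 𝔽_p²` of a `2 × 2` matrix `A` has exactly `p` elements then `A ≠ 0` and `det A = 0`.

Checked independently by machine for `p ≤ 17` over ALL conjugacy classes of subgroups of
`GL₂(𝔽_p)` (GAP, `ConjugacyClassesSubgroups`) and for `p ≤ 23` at the level of pairs of
transvections and of the explicit Cartan-normaliser / `𝔖₄` / `𝔄₄` / `𝔄₅` subgroups (pure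
Python), see the X9 packet of the BSD rank-≤1 residual cell; the theorems below are the uniform
statements for every prime `p`.

## References

* [Serre1972] J.-P. Serre, *Propriétés galoisiennes des points d'ordre fini des courbes
  elliptiques*, Invent. Math. 15 (1972) 259–331, §2.4 Prop. 15, §2.6 (the exceptional
  subgroups have order prime to `p`), §5.4 proof of Prop. 21 i).
* [Kato2004] K. Kato, *`p`-adic Hodge theory and values of zeta functions of modular forms*,
  Astérisque 295 (2004), Thm. 13.4 (3), (12.5.2), Thm. 17.4 (3).
* [Skinner2016PacificMC] C. Skinner, Pacific J. Math. 283 (2016), §2.5, hypotheses (a), (b).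
* [BurungaleCastellaSkinner2025] A. Burungale, F. Castella, C. Skinner, IMRN 2025 (rnaf082) =
  arXiv:2405.00270, hypotheses (irr_ℚ), (im), (sur); Remark 1.1.3 (iii).
-/

open Matrix
open scoped MatrixGroups

namespace Literature.NumberTheory.GaloisRepresentations.Serre1972

/-! ### `2 × 2` linear algebra -/

section Field

variable {F : Type*} [Field F]

/-- `det (M - 1) = det M - tr M + 1` for a `2 × 2` matrix `M` (the characteristic polynomial of
`M` evaluated at `1`). [folklore] -/
theorem det_sub_one_fin_two (M : Matrix (Fin 2) (Fin 2) F) :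
    (M - 1).det = M.det - M.trace + 1 := by
  simp only [Matrix.det_fin_two, Matrix.trace_fin_two, Matrix.sub_apply, Matrix.one_apply_eq,
    Matrix.one_apply_ne (show (0 : Fin 2) ≠ 1 by decide),
    Matrix.one_apply_ne (show (1 : Fin 2) ≠ 0 by decide)]
  ring

end Field

/-! ### Over the prime field `𝔽_p` -/

section Prime

variable {p : ℕ} [Fact p.Prime]

/-- **A σ-type element of `GL₂(𝔽_p)` is a transvection of order `p`.**  If `g ∈ GL₂(𝔽_p)` has
`det g = 1`, `g ≠ 1` and `det (g - 1) = 0` (so `1` is an eigenvalue, hence both eigenvalues are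
`1`), then `tr g = 2`, `(g - 1)² = 0` by Cayley–Hamilton, `g^p = 1 + p·(g - 1) = 1`, and `g` has
order exactly `p`.  (Serre 1972, §2.4: the elements of order `p` of `GL(V)` are the transvections
`(1 1; 0 1)`; this is the converse direction of the tree's
`sub_one_ne_zero_and_mul_self_eq_zero_of_orderOf_eq`.) [cite: Serre1972, §2.4, proof of Prop. 15] -/
theorem orderOf_eq_of_det_eq_one_of_det_sub_one_eq_zero {g : GL (Fin 2) (ZMod p)}
    (hdet : Matrix.GeneralLinearGroup.det g = 1)
    (hne : g ≠ 1)
    (hsing : ((g : Matrix (Fin 2) (Fin 2) (ZMod p)) - 1).det = 0) :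
    orderOf g = p := by
  set N : Matrix (Fin 2) (Fin 2) (ZMod p) := (g : Matrix (Fin 2) (Fin 2) (ZMod p)) - 1 with hN
  have hdetM : (g : Matrix (Fin 2) (Fin 2) (ZMod p)).det = 1 := by
    have h := congrArg Units.val hdet
    rwa [Matrix.GeneralLinearGroup.val_det_apply, Units.val_one] at h
  have htr : (g : Matrix (Fin 2) (Fin 2) (ZMod p)).trace = 2 := by
    have h := det_sub_one_fin_two (g : Matrix (Fin 2) (Fin 2) (ZMod p))
    rw [hsing, hdetM] at h
    linear_combination h
  have htrN : N.trace = 0 := by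
    rw [hN, Matrix.trace_sub, Matrix.trace_one, htr, Fintype.card_fin]
    norm_num
  have hdetN : N.det = 0 := hsing
  have hNN : N * N = 0 := by
    rw [DeligneSerre1974.TwoByTwo.mul_self_eq N, htrN, hdetN, zero_smul, zero_smul, sub_zero]
  have hgp : g ^ p = 1 := by
    apply Units.ext
    rw [Units.val_pow_eq_pow_val, Units.val_one]
    have hg : (g : Matrix (Fin 2) (Fin 2) (ZMod p)) = 1 + N := by rw [hN]; abel
    rw [hg, DeligneSerre1974.one_add_pow_of_mul_self_eq_zero hNN p, ZMod.natCast_self, zero_smul,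
      add_zero]
  exact orderOf_eq_prime hgp hne

/-- An element of order `p` in a subgroup `G ≤ GL₂(𝔽_p)` makes `p` divide `#G` (Lagrange).
[folklore] -/
theorem dvd_natCard_of_mem_of_orderOf_eq {G : Subgroup (GL (Fin 2) (ZMod p))}
    {g : GL (Fin 2) (ZMod p)} (hg : g ∈ G) (h : orderOf g = p) : p ∣ Nat.card G := by
  have hdvd := orderOf_dvd_natCard (⟨g, hg⟩ : G)
  rwa [Subgroup.orderOf_mk, h] at hdvd

/-- **Serre's Prop. 15 read backwards: a proper subgroup of `GL₂(𝔽_p)` with full determinant and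
no common eigenvector has order prime to `p`.**  (If `p ∣ #G` then `G ⊇ SL₂(𝔽_p)`, hence
`G = GL₂(𝔽_p)` as `det G = 𝔽_pˣ`, or `G` lies in a Borel subgroup — Serre 1972, §2.4 Prop. 15 with
§5.2 (iii); both excluded.)  This is the common property of the "exceptional" images of Serre's
classification (normaliser of a split / non-split Cartan subgroup not in a Borel, projective image
`𝔄₄`, `𝔖₄` or `𝔄₅`: §2.5–2.6) that the Euler-system arguments run into.
[cite: Serre1972, §2.4 Prop. 15; §5.4, proof of Prop. 21 i)] -/
theorem not_dvd_natCard_of_forall_not_le_eigenvectorStabilizer (G : Subgroup (GL (Fin 2) (ZMod p)))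
    (hdet : ∀ u : (ZMod p)ˣ, ∃ g ∈ G, Matrix.GeneralLinearGroup.det g = u)
    (hG : G ≠ ⊤)
    (hirr : ∀ (v : Fin 2 → ZMod p) (hv : v ≠ 0), ¬ G ≤ eigenvectorStabilizer v hv) :
    ¬ p ∣ Nat.card G := by
  intro hdvd
  rcases eq_top_or_borel_of_dvd_card G hdvd hdet with h | ⟨v, hv, hB⟩
  · exact hG h
  · exact hirr v hv hB

/-- **No σ-type element in an exceptional image.**  Let `G < GL₂(𝔽_p)` be a proper subgroup with
`det G = 𝔽_pˣ` and no common eigenvector.  Then every `g ∈ G` with `det g = 1` and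
`det (g - 1) = 0` is the identity: `G ∩ SL₂(𝔽_p)` contains no element `g ≠ 1` with a fixed
line on which... i.e. no transvection — so no element of `G` can be the reduction of a
`σ ∈ G_{ℚ(μ_{p^∞})}` with `T/(σ - 1)T` free of rank one (hypothesis (im) of
Burungale–Castella–Skinner 2025 / Kato's Thm. 13.4 (3) / Skinner 2016 §2.5 (b)).
[cite: Serre1972, §2.4 Prop. 15; §2.6] -/
theorem eq_one_of_det_eq_one_of_det_sub_one_eq_zero (G : Subgroup (GL (Fin 2) (ZMod p)))
    (hdet : ∀ u : (ZMod p)ˣ, ∃ g ∈ G, Matrix.GeneralLinearGroup.det g = u)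
    (hG : G ≠ ⊤)
    (hirr : ∀ (v : Fin 2 → ZMod p) (hv : v ≠ 0), ¬ G ≤ eigenvectorStabilizer v hv)
    {g : GL (Fin 2) (ZMod p)} (hg : g ∈ G) (hdet1 : Matrix.GeneralLinearGroup.det g = 1)
    (hsing : ((g : Matrix (Fin 2) (Fin 2) (ZMod p)) - 1).det = 0) :
    g = 1 := by
  by_contra hne
  exact not_dvd_natCard_of_forall_not_le_eigenvectorStabilizer G hdet hG hirr
    (dvd_natCard_of_mem_of_orderOf_eq hg
      (orderOf_eq_of_det_eq_one_of_det_sub_one_eq_zero hdet1 hne hsing))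

/-- **Linear-algebra bridge.**  If the image `A · 𝔽_p² = {A v}` of a `2 × 2` matrix `A` over
`𝔽_p` has exactly `p` elements, then `A ≠ 0` and `det A = 0` (were `A = 0` the image would have
`1` element, were `A` invertible it would have `p²`).  Used with `A = ρ̄(σ) - 1`: "the cokernel
of `σ - 1` on `E[p]` is a line" is `#(σ - 1)E[p] = p`. [folklore] -/
theorem ne_zero_and_det_eq_zero_of_natCard_range_mulVecLin {A : Matrix (Fin 2) (Fin 2) (ZMod p)}
    (h : Nat.card (LinearMap.range (Matrix.mulVecLin A)) = p) :
    A ≠ 0 ∧ A.det = 0 := by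
  have hp : p.Prime := Fact.out
  constructor
  · rintro rfl
    have h1 : Nat.card (LinearMap.range (Matrix.mulVecLin (0 : Matrix (Fin 2) (Fin 2) (ZMod p))))
        = 1 := by
      rw [Matrix.mulVecLin_zero, LinearMap.range_zero]
      exact Nat.card_unique
    rw [h1] at h
    exact hp.one_lt.ne h
  · by_contra hdet
    have hunit : IsUnit A := (Matrix.isUnit_iff_isUnit_det A).mpr (Ne.isUnit hdet)
    have hsurj : Function.Surjective (Matrix.mulVecLin A) := by
      rw [Matrix.coe_mulVecLin]
      exact Matrix.mulVec_surjective_iff_isUnit.mpr hunit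
    have htop : LinearMap.range (Matrix.mulVecLin A) = ⊤ := LinearMap.range_eq_top.mpr hsurj
    have h2 : Nat.card (LinearMap.range (Matrix.mulVecLin A)) = p ^ 2 := by
      rw [htop, Nat.card_congr (Submodule.topEquiv (R := ZMod p) (M := Fin 2 → ZMod p)).toEquiv,
        Nat.card_fun, Nat.card_zmod, Nat.card_eq_fintype_card, Fintype.card_fin]
    rw [h2] at h
    have : p ^ 2 = p ^ 1 := by rw [h, pow_one]
    exact absurd (Nat.pow_right_injective hp.two_le this) (by norm_num)

end Prime

end Literature.NumberTheory.GaloisRepresentations.Serre1972
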